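import Summits.CriticalPhenomena.PercolationContinuityZ3.Theorems.Transplant.SkelPhiRunSideForms
import Summits.CriticalPhenomena.PercolationContinuityZ3.Theorems.Transplant.SkelPhiEquilibriumWDefs
import HarnessLib

/-!
# N1 (the `{±1}` node), LEVEL 1, kit adapter file N-K6b: THE EXIT PIECES OF A RUN-LEVEL KIT — which SHORT piece of the kit centre `c` lies below
# the shell line of each side of a run window, in terms of the side forms `rawSide` / `levSide` (`SkelPhiRunSideForms`): through a RAW side
# (`α = const`) the outward x-family side half (exact `Δα = ±n_s`); through a LEVEL side (`β′_L = const`, long shear) the outward y-family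
# top/bottom piece of the short data, under the located inequality (lane INBOX 2026-08-21 15:35Z)
#   `n_L·(n_s ℓ_s − U_s + 1) − |n_L h_s − h_L n_s|·n_s ≥ (A + n_L)·n_s`
# (the short piece must clear the zone's height across the slope mismatch of the two equilibria)

builds on p205010 (kernel theorem, internal audit signed; external expert review pending) — nothing in this file uses p205010; nothing here is a
claim about the open node `SamePDropOfSkeletonNeg`.
Lane `prim-bschramm`, seat `prim-bschramm-p1` (gen 11; design KIT-APRON-N1); helper file (`--supports stmt-CriticalPhenomena-4575 --as helper`).
* `shear_transfer` (`n_s·β′_L = n_L·β′_s + (n_L h_s − h_L n_s)·α`), `rawSide_lin_sub`, `levSide_lin_sub`;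
* **`exit_rawSide_sideHalf`**: `w ∈ pgSideHalfW c n_s h_s ℓ_s R (σ₀σ) τ` ⇒ `L(φ w) + A + C ≤ L(φ c)` for the raw side form (`n_s ≥ A + 1`, `C = 1`);
* **`exit_levSide_topPiece`**: `w ∈ pgTopPieceW c n_s h_s ℓ_s R (σ₀σ) τ v` ⇒ the same for the level side form (`C = n_L`), under the inequality above.
[cite: MartineauTassion2017, §3.2 (𝒵(a,b,u,v), L(−a,v), L(v,b))] [cite: KozmaNitzan2024, §4 p. 20 (Step IV)]
-/

noncomputable section

open scoped Classical

namespace Summit.CriticalPhenomena.PercolationContinuityZ3.Theorems.Transplant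

namespace Skelφ

open Literature.Probability.Percolation Literature.Probability.LatticeModels SimpleGraph
open Literature.Probability.Percolation.KozmaNitzan.Cells (oth oth_ne eq_oth_of_ne oth_oth)

variable {V : Type} {G : SimpleGraph V} [G.LocallyFinite] {φ : V → Site 2}

omit [G.LocallyFinite] in
/-- **Shear transfer**: `n_s·β′_L(w) = n_L·β′_s(w) + (n_L h_s − h_L n_s)·α(w)` (relative to the same base vertex). [folklore] -/
theorem shear_transfer (c : V) (nL nS : ℕ) (hL hS : ℤ) (w : V) :
    (nS : ℤ) * shearCoord φ c nL hL w = (nL : ℤ) * shearCoord φ c nS hS w + ((nL : ℤ) * hS - hL * nS) * relCoord φ c 0 w := by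
  simp only [shearCoord_apply, relCoord_apply]; ring

omit [G.LocallyFinite] in
/-- The raw side form along a vertex: `L(φ w) − L(φ c) = −σ₀σ·α_c(w)`. [folklore] -/
theorem rawSide_lin_sub {ψ : V → Site 2} (c₀ : V) (σ : ℤ) (hσ : σ = 1 ∨ σ = -1) (Lo Hi : Site 2) (i : Fin 2) (σ₀ : ℤˣ)
    (hraw : ∀ w, ψ w i = σ * (φ w 0 - φ c₀ 0)) (c w : V) :
    (rawSide ψ c₀ σ hσ Lo Hi i σ₀ hraw).lin (φ w) - (rawSide ψ c₀ σ hσ Lo Hi i σ₀ hraw).lin (φ c) = -((σ₀ : ℤ) * σ) * relCoord φ c 0 w := by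
  simp only [SideForm.lin, rawSide, linForm, relCoord_apply]; ring

omit [G.LocallyFinite] in
/-- The level side form along a vertex: `L(φ w) − L(φ c) = −σ₀σ·β′_c(w)` (long shear). [folklore] -/
theorem levSide_lin_sub {ψ : V → Site 2} (c₀ : V) {n : ℕ} (hn : 1 ≤ n) (h σ : ℤ) (hσ : σ = 1 ∨ σ = -1) (Lo Hi : Site 2) (i : Fin 2) (σ₀ : ℤˣ)
    (hlev : ∀ w, ψ w i = (σ * shearCoord φ c₀ n h w) / (shearUnit n h : ℤ)) (c w : V) :
    (levSide ψ c₀ hn h σ hσ Lo Hi i σ₀ hlev).lin (φ w) - (levSide ψ c₀ hn h σ hσ Lo Hi i σ₀ hlev).lin (φ c) = -((σ₀ : ℤ) * σ) * shearCoord φ c n h w := by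
  simp only [SideForm.lin, levSide, linForm, shearCoord_apply]; ring

omit [G.LocallyFinite] in
/-- The climbing coefficient of the raw side form is `1`. [folklore] -/
theorem rawSide_C {ψ : V → Site 2} (c₀ : V) (σ : ℤ) (hσ : σ = 1 ∨ σ = -1) (Lo Hi : Site 2) (i : Fin 2) (σ₀ : ℤˣ)
    (hraw : ∀ w, ψ w i = σ * (φ w 0 - φ c₀ 0)) :
    ((rawSide ψ c₀ σ hσ Lo Hi i σ₀ hraw).s : ℤ) * coef (rawSide ψ c₀ σ hσ Lo Hi i σ₀ hraw).cα (rawSide ψ c₀ σ hσ Lo Hi i σ₀ hraw).cβ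
      (rawSide ψ c₀ σ hσ Lo Hi i σ₀ hraw).a = 1 := by
  have hs := val_sgnU hσ
  have h1 : (σ₀ : ℤ) * (σ₀ : ℤ) = 1 := by rcases Int.units_eq_one_or σ₀ with h | h <;> simp [h]
  have h2 : σ * σ = 1 := by rcases hσ with rfl | rfl <;> simp
  have hc : coef (-((σ₀ : ℤ) * σ)) 0 0 = -((σ₀ : ℤ) * σ) := by simp [coef]
  show (((-(σ₀ * sgnU σ)) : ℤˣ) : ℤ) * coef (-((σ₀ : ℤ) * σ)) 0 0 = 1
  rw [hc, Units.val_neg, Units.val_mul, hs]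
  linear_combination (σ * σ) * h1 + h2

omit [G.LocallyFinite] in
/-- The climbing coefficient of the level side form is `n_L`. [folklore] -/
theorem levSide_C {ψ : V → Site 2} (c₀ : V) {n : ℕ} (hn : 1 ≤ n) (h σ : ℤ) (hσ : σ = 1 ∨ σ = -1) (Lo Hi : Site 2) (i : Fin 2) (σ₀ : ℤˣ)
    (hlev : ∀ w, ψ w i = (σ * shearCoord φ c₀ n h w) / (shearUnit n h : ℤ)) :
    ((levSide ψ c₀ hn h σ hσ Lo Hi i σ₀ hlev).s : ℤ) * coef (levSide ψ c₀ hn h σ hσ Lo Hi i σ₀ hlev).cα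
      (levSide ψ c₀ hn h σ hσ Lo Hi i σ₀ hlev).cβ (levSide ψ c₀ hn h σ hσ Lo Hi i σ₀ hlev).a = n := by
  have hs := val_sgnU hσ
  have h1 : (σ₀ : ℤ) * (σ₀ : ℤ) = 1 := by rcases Int.units_eq_one_or σ₀ with h | h <;> simp [h]
  have h2 : σ * σ = 1 := by rcases hσ with rfl | rfl <;> simp
  have hc : coef ((σ₀ : ℤ) * σ * h) (-((σ₀ : ℤ) * σ * n)) 1 = -((σ₀ : ℤ) * σ * n) := by simp [coef]
  show (((-(σ₀ * sgnU σ)) : ℤˣ) : ℤ) * coef ((σ₀ : ℤ) * σ * h) (-((σ₀ : ℤ) * σ * n)) 1 = n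
  rw [hc, Units.val_neg, Units.val_mul, hs]
  linear_combination (n : ℤ) * ((σ * σ) * h1 + h2)

/-- **RAW-SIDE EXIT**: every vertex of the outward short side half `pgSideHalfW c n_s h_s ℓ_s R (σ₀σ) τ` satisfies `L(φ w) + A + C ≤ L(φ c)` for
the raw side form, as soon as `A + 1 ≤ n_s`. [cite: MartineauTassion2017, §3.2] -/
theorem exit_rawSide_sideHalf {ψ : V → Site 2} (c₀ : V) (σ : ℤ) (hσ : σ = 1 ∨ σ = -1) (Lo Hi : Site 2) (i : Fin 2) (σ₀ : ℤˣ)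
    (hraw : ∀ w, ψ w i = σ * (φ w 0 - φ c₀ 0)) {nS ℓS R : ℕ} {hS : ℤ} {A : ℤ} (hA : A + 1 ≤ nS) {c w : V} {τ : ℤ}
    (hw : w ∈ pgSideHalfW G φ c nS hS ℓS R ((σ₀ : ℤ) * σ) τ) :
    (rawSide ψ c₀ σ hσ Lo Hi i σ₀ hraw).lin (φ w) + A +
        ((rawSide ψ c₀ σ hσ Lo Hi i σ₀ hraw).s : ℤ) * coef (rawSide ψ c₀ σ hσ Lo Hi i σ₀ hraw).cα (rawSide ψ c₀ σ hσ Lo Hi i σ₀ hraw).cβ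
          (rawSide ψ c₀ σ hσ Lo Hi i σ₀ hraw).a ≤ (rawSide ψ c₀ σ hσ Lo Hi i σ₀ hraw).lin (φ c) := by
  rw [rawSide_C]
  have hd := rawSide_lin_sub (φ := φ) c₀ σ hσ Lo Hi i σ₀ hraw c w
  obtain ⟨-, -, hα, -⟩ := (mem_pgSideHalfW G φ).1 hw
  rw [hα] at hd
  have h1 : (σ₀ : ℤ) * (σ₀ : ℤ) = 1 := by rcases Int.units_eq_one_or σ₀ with h | h <;> simp [h]
  have h2 : σ * σ = 1 := by rcases hσ with rfl | rfl <;> simp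
  have e : -((σ₀ : ℤ) * σ) * ((σ₀ : ℤ) * σ * nS) = -(((σ₀ : ℤ) * (σ₀ : ℤ)) * (σ * σ)) * nS := by ring
  rw [e, h1, h2] at hd
  linarith

/-- **LEVEL-SIDE EXIT**: every vertex of the outward short top/bottom piece `pgTopPieceW c n_s h_s ℓ_s R (σ₀σ) τ v` satisfies
`L(φ w) + A + C ≤ L(φ c)` for the LEVEL side form of the long data `(n_L, h_L)`, under
`n_L (n_s ℓ_s − U_s + 1) − |n_L h_s − h_L n_s| n_s ≥ (A + n_L) n_s` (`1 ≤ n_s`). [cite: MartineauTassion2017, §3.2] -/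
theorem exit_levSide_topPiece {ψ : V → Site 2} (c₀ : V) {nL : ℕ} (hnL : 1 ≤ nL) (hL σ : ℤ) (hσ : σ = 1 ∨ σ = -1) (Lo Hi : Site 2) (i : Fin 2)
    (σ₀ : ℤˣ) (hlev : ∀ w, ψ w i = (σ * shearCoord φ c₀ nL hL w) / (shearUnit nL hL : ℤ)) {nS ℓS R : ℕ} (hnS : 1 ≤ nS) {hS : ℤ} {A : ℤ}
    (hexit : (A + nL) * nS ≤ (nL : ℤ) * ((nS : ℤ) * ℓS - shearUnit nS hS + 1) - |(nL : ℤ) * hS - hL * nS| * nS) {c w : V} {τ v : ℤ}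
    (hw : w ∈ pgTopPieceW G φ c nS hS ℓS R ((σ₀ : ℤ) * σ) τ v) :
    (levSide ψ c₀ hnL hL σ hσ Lo Hi i σ₀ hlev).lin (φ w) + A +
        ((levSide ψ c₀ hnL hL σ hσ Lo Hi i σ₀ hlev).s : ℤ) * coef (levSide ψ c₀ hnL hL σ hσ Lo Hi i σ₀ hlev).cα
          (levSide ψ c₀ hnL hL σ hσ Lo Hi i σ₀ hlev).cβ (levSide ψ c₀ hnL hL σ hσ Lo Hi i σ₀ hlev).a ≤
      (levSide ψ c₀ hnL hL σ hσ Lo Hi i σ₀ hlev).lin (φ c) := by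
  rw [levSide_C]
  have hd := levSide_lin_sub (φ := φ) c₀ hnL hL σ hσ Lo Hi i σ₀ hlev c w
  obtain ⟨-, hcyl, htop, -⟩ := (mem_pgTopPieceW G φ).1 hw
  rw [mem_pgramCyl] at hcyl
  have hα := hcyl.1
  rw [abs_le] at hα
  -- `e · β′_L(w) ≥ …` with `e = σ₀σ`
  obtain ⟨e, he⟩ : ∃ e : ℤ, e = (σ₀ : ℤ) * σ := ⟨_, rfl⟩
  rw [← he] at hd htop
  have he1 : |e| = 1 := by
    rcases Int.units_eq_one_or σ₀ with h | h <;> rcases hσ with h' | h' <;> simp [he, h, h']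
  have hnS0 : (0 : ℤ) < nS := by exact_mod_cast hnS
  have hU : ((shearUnit nS hS : ℕ) : ℤ) = ((nS + hS.natAbs : ℕ) : ℤ) := rfl
  -- shear transfer, multiplied by `e`
  have htr := shear_transfer (φ := φ) c nL nS hL hS w
  -- `e · (E · α) ≥ −|E| · n_s`
  have hEα : -(|(nL : ℤ) * hS - hL * nS| * nS) ≤ e * (((nL : ℤ) * hS - hL * nS) * relCoord φ c 0 w) := by
    have hb : |e * (((nL : ℤ) * hS - hL * nS) * relCoord φ c 0 w)| ≤ |(nL : ℤ) * hS - hL * nS| * nS := by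
      rw [abs_mul, abs_mul, he1, one_mul]
      exact mul_le_mul_of_nonneg_left (abs_le.2 ⟨hα.1, hα.2⟩) (abs_nonneg _)
    rw [abs_le] at hb; exact hb.1
  -- `n_s · (e β′_L) = n_L (e β′_s) + e E α ≥ n_L (n_s ℓ_s − U_s + 1) − |E| n_s`
  have hkey : (A + nL) * nS ≤ (nS : ℤ) * (e * shearCoord φ c nL hL w) := by
    have h1 : (nS : ℤ) * (e * shearCoord φ c nL hL w) = (nL : ℤ) * (e * shearCoord φ c nS hS w) + e * (((nL : ℤ) * hS - hL * nS) * relCoord φ c 0 w) := by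
      linear_combination e * htr
    have h2 : (nS : ℤ) * ℓS - shearUnit nS hS + 1 ≤ e * shearCoord φ c nS hS w := by
      rw [hU]; linarith [htop]
    have h3 : (nL : ℤ) * ((nS : ℤ) * ℓS - shearUnit nS hS + 1) ≤ (nL : ℤ) * (e * shearCoord φ c nS hS w) :=
      mul_le_mul_of_nonneg_left h2 (by positivity)
    linarith
  -- divide by `n_s`
  have hdiv : A + nL ≤ e * shearCoord φ c nL hL w := le_of_mul_le_mul_right (by linarith [hkey]) hnS0
  linarith [hd]

end Skelφ

end Summit.CriticalPhenomena.PercolationContinuityZ3.Theorems.Transplant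

end
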